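import Mathlib
import HarnessLib

/-!
# The marked monomial game (E-resolution of marked monomial ideals, abstract ray-name model) — part A

Sources.  R. Blanco, *Desingularization of binomial varieties in arbitrary characteristic. Part I*,
Math. Nachr. **285** (2012) [Blanco2012a] (held preprint arXiv:0902.2887, its numbering): Def. 1.18 (E-singular
locus), Def. 1.22 / Rem. 1.23 (transformation at a combinatorial centre), Def. 1.24 (E-resolution), §4 Algorithm 4.4
and Thm. 4.6 (the resolution exists); S. Encinas, O. Villamayor, *Good points and constructive resolution of
singularities*, Acta Math. **181** (1998) [EncinasVillamayor1998]: Def. 1.4 (transform law) and §2 «the monomial case»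
(printed pp. 115–116).

## What this file is

The MONOMIAL case of Blanco's Thm. 4.6 / of Encinas–Villamayor's constructive resolution, in the purely
combinatorial form used by the tree's fan-stage rendering (`MonomialEResolution.lean`: `HStageN`, `LegalFaceN`,
`StrictWonN`), but over ABSTRACT RAY NAMES (`ℕ`), any dimension `n`, marking normalised to `1`:

* a STATE (`MGame ι`) is a finite set of cones (finite sets of ray names) with an exponent table
  `expo : ℕ → ι → ℚ` (`ι` = the generators of the monomial ideal) and the set `used` of names spent so far;
* a face `R` is LEGAL iff it is a non-empty subface of a cone and `Σ_{r∈R} expo r v ≥ 1` for every generator `v`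
  (the orbit closure of `R` lies in `E-Sing(J, c)`, [Blanco2012a, Def. 1.18]);
* the MOVE at `R` with a fresh name `ρ` gives `ρ` the exponents `Σ_R expo − 1` (controlled transform,
  [EncinasVillamayor1998, Def. 1.4]) and replaces every cone `C ⊇ R` by its children `C − x + ρ`, `x ∈ R`
  (the charts of the blow-up, [Blanco2012a, Def. 1.22, Rem. 1.23]);
* a cone is DONE iff some generator has exponent sum `< 1` on it (`E-Sing = ∅` on that chart, [Blanco2012a, Def. 1.24]);
* `Solvable s`: some finite sequence of legal moves reaches a state all of whose cones are done — with the fresh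
  names chosen ADVERSARIALLY at every step (so that a consumer may impose its own naming, e.g. `ρ_R = Σ_{r∈R} r` on
  fan stages, and so that the dimension recursion of part B can pass names down).

Part A (this file): the definitions, the invariants (`WF`: cone size, names, non-negativity; common denominators),
the one-step formulas, the Encinas–Villamayor bookkeeping `J = M · I` WITHOUT history (§3: `alpha`/`pexp`/`theta`
relative to the set `OLD` of names present at the start), the three phase facts (allowed moves keep the residual
order from rising; the contact set `U` of an active cone lies inside every allowed face through it), and the
MONOMIAL PHASE (§5): when every not-done cone has residual order `0`, the state is solvable — Encinas–Villamayor's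
monomial case, existence form (blow up an inclusion-minimal face of the monomial part; the potential
`Σ_C (n+1)^{N·Σ_C α}` drops).  Part B (`MonomialMarkedGameResolution.lean`) adds the junior (link) game at a
contact ray and the recursion on the dimension, proving that EVERY well-formed state is solvable.

Everything here is proved; no named fact is introduced.  OURS rendering choices (names, adversarial naming, the
history-free bookkeeping) are ours; the mathematics is the cited monomial case.  Not here: schemes, fans, vectors,
heights (the transport to `HStageN` is a separate file), the resolution invariant `t` of [Blanco2012a, Def. 3.20]
(only EXISTENCE of a resolution is formalised), binomial ideals.
-/

namespace Literature.Combinatorics.HironakaPolyhedraGame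

open Finset
open scoped BigOperators

/-- A state of the marked monomial game over the generator type `ι`: the maximal cones (finite sets of ray
names), the exponent table (`expo r v` = exponent of the variable of ray `r` in the transform of generator `v`,
normalised by the marking), and the names used so far.  [cite: Blanco2012a, Def. 1.15–1.16 with Rem. 1.23
(arXiv 0902.2887 numbering)] -/
structure MGame (ι : Type) where
  /-- the maximal cones, as finite sets of ray names -/
  cones : Finset (Finset ℕ)
  /-- `expo r v`: normalised exponent of ray `r` in generator `v` -/
  expo : ℕ → ι → ℚ
  /-- every name that occurs or has occurred (fresh names are taken outside this set) -/
  used : Finset ℕ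

namespace MGame

variable {ι : Type}

/-- `Σ_{r ∈ R} expo r v`: the (normalised) E-order of generator `v` along the stratum of the face `R`.
[cite: Blanco2012a, Def. 1.10, Rem. 1.12–1.13] -/
def fsum (s : MGame ι) (R : Finset ℕ) (v : ι) : ℚ := ∑ r ∈ R, s.expo r v

/-- LEGAL centre: a non-empty face of some cone along whose stratum every generator has order `≥ 1`
(the orbit closure lies in `E-Sing(J, c)`).  [cite: Blanco2012a, Def. 1.18, Rem. 1.23] -/
def Legal (s : MGame ι) (R : Finset ℕ) : Prop :=
  R.Nonempty ∧ (∃ C ∈ s.cones, R ⊆ C) ∧ ∀ v, (1 : ℚ) ≤ s.fsum R v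

/-- DONE cone: some generator has order `< 1` at the corner (the chart misses `E-Sing(J, c)`).
[cite: Blanco2012a, Def. 1.18, Def. 1.24] -/
def Done (s : MGame ι) (C : Finset ℕ) : Prop := ∃ v, s.fsum C v < 1

/-- Every cone is done: `E-Sing(J, c) = ∅`, the end of an E-resolution.  [cite: Blanco2012a, Def. 1.24] -/
def AllDone (s : MGame ι) : Prop := ∀ C ∈ s.cones, s.Done C

/-- The cones replacing `C` when the face `R` is blown up with new ray `ρ`: untouched if `R ⊄ C`, else the
children `C − x + ρ`, `x ∈ R` (the charts of the blow-up).  [cite: Blanco2012a, Def. 1.22, Rem. 1.23] -/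
def childCones (R C : Finset ℕ) (ρ : ℕ) : Finset (Finset ℕ) :=
  if R ⊆ C then R.image (fun x => insert ρ (C.erase x)) else {C}

/-- The MOVE: blow up the face `R`, naming the new ray `ρ`; its exponents are `Σ_R expo − 1` (controlled
transform «total transform ÷ I(Y′)^c», normalised).  [cite: EncinasVillamayor1998, Def. 1.4]
[cite: Blanco2012a, Def. 1.22] -/
def move (s : MGame ι) (R : Finset ℕ) (ρ : ℕ) : MGame ι where
  cones := s.cones.biUnion (fun C => childCones R C ρ)
  expo := Function.update s.expo ρ (fun v => s.fsum R v - 1)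
  used := insert ρ s.used

/-- A FRESH name. [cite: Blanco2012a, Rem. 1.23] -/
def Fresh (s : MGame ι) (ρ : ℕ) : Prop := ρ ∉ s.used

/-- SOLVABLE state: a finite sequence of legal moves — with the fresh names chosen adversarially — reaches a state
all of whose cones are done (an E-resolution exists, [Blanco2012a, Def. 1.24, Thm. 4.6 C)]).
[cite: Blanco2012a, Def. 1.24] -/
inductive Solvable : MGame ι → Prop
  | done {s : MGame ι} : s.AllDone → Solvable s
  | step {s : MGame ι} (R : Finset ℕ) :
      s.Legal R → (∀ ρ, s.Fresh ρ → Solvable (s.move R ρ)) → Solvable s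

/-- WELL-FORMED state of dimension `n`: cones are `n`-sets of used names and carry non-negative exponents.
[cite: Blanco2012a, Def. 1.15–1.16] -/
structure WF (n : ℕ) (s : MGame ι) : Prop where
  /-- every cone has exactly `n` rays -/
  card_eq : ∀ C ∈ s.cones, C.card = n
  /-- rays of cones are used names -/
  subset_used : ∀ C ∈ s.cones, C ⊆ s.used
  /-- exponents on rays of cones are non-negative -/
  nonneg : ∀ C ∈ s.cones, ∀ r ∈ C, ∀ v, 0 ≤ s.expo r v

/-- All exponents on cones have denominator dividing `N` (a common denominator; preserved by moves).
[cite: Blanco2012a, Def. 1.22] -/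
def IsLattice (N : ℕ) (s : MGame ι) : Prop :=
  ∀ C ∈ s.cones, ∀ r ∈ C, ∀ v, ∃ z : ℤ, s.expo r v = z / N

/-! ## §1 One-step formulas -/

section Basic

/-- Unfolding of `fsum`. [cite: Blanco2012a, Def. 1.10] -/
theorem fsum_def (s : MGame ι) (R : Finset ℕ) (v : ι) : s.fsum R v = ∑ r ∈ R, s.expo r v := rfl

/-- Exponents of old names are unchanged by a move. [cite: Blanco2012a, Def. 1.22] -/
theorem expo_move_of_ne (s : MGame ι) (R : Finset ℕ) {ρ r : ℕ} (h : r ≠ ρ) (v : ι) :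
    (s.move R ρ).expo r v = s.expo r v := by
  simp [move, Function.update_of_ne h]

/-- The new ray's exponents. [cite: EncinasVillamayor1998, Def. 1.4] -/
theorem expo_move_self (s : MGame ι) (R : Finset ℕ) (ρ : ℕ) (v : ι) :
    (s.move R ρ).expo ρ v = s.fsum R v - 1 := by
  simp [move]

/-- The used names after a move. [cite: Blanco2012a, Def. 1.22] -/
theorem used_move (s : MGame ι) (R : Finset ℕ) (ρ : ℕ) : (s.move R ρ).used = insert ρ s.used := rfl

/-- Face sums over faces avoiding the new name are unchanged. [cite: Blanco2012a, Def. 1.22] -/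
theorem fsum_move_of_not_mem (s : MGame ι) (R : Finset ℕ) {ρ : ℕ} {T : Finset ℕ} (h : ρ ∉ T) (v : ι) :
    (s.move R ρ).fsum T v = s.fsum T v := by
  unfold fsum
  refine Finset.sum_congr rfl (fun r hr => ?_)
  exact expo_move_of_ne s R (ne_of_mem_of_not_mem hr h) v

/-- Membership in the cones after a move: an untouched old cone, or a child `C − x + ρ` of a cone `C ⊇ R`.
[cite: Blanco2012a, Def. 1.22, Rem. 1.23] -/
theorem mem_move_cones {s : MGame ι} {R : Finset ℕ} {ρ : ℕ} {D : Finset ℕ} :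
    D ∈ (s.move R ρ).cones ↔
      (D ∈ s.cones ∧ ¬ R ⊆ D) ∨ ∃ C ∈ s.cones, R ⊆ C ∧ ∃ x ∈ R, D = insert ρ (C.erase x) := by
  simp only [move, Finset.mem_biUnion, childCones]
  constructor
  · rintro ⟨C, hC, hD⟩
    by_cases hRC : R ⊆ C
    · rw [if_pos hRC, Finset.mem_image] at hD
      obtain ⟨x, hx, rfl⟩ := hD
      exact Or.inr ⟨C, hC, hRC, x, hx, rfl⟩
    · rw [if_neg hRC, Finset.mem_singleton] at hD
      subst hD
      exact Or.inl ⟨hC, hRC⟩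
  · rintro (⟨hD, hRD⟩ | ⟨C, hC, hRC, x, hx, rfl⟩)
    · exact ⟨D, hD, by rw [if_neg hRD, Finset.mem_singleton]⟩
    · exact ⟨C, hC, by rw [if_pos hRC]; exact Finset.mem_image_of_mem _ hx⟩

/-- An old cone not containing `R` survives the move. [cite: Blanco2012a, Def. 1.22] -/
theorem mem_move_cones_of_not_subset {s : MGame ι} {R : Finset ℕ} (ρ : ℕ) {D : Finset ℕ}
    (hD : D ∈ s.cones) (hRD : ¬ R ⊆ D) : D ∈ (s.move R ρ).cones :=
  mem_move_cones.mpr (Or.inl ⟨hD, hRD⟩)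

/-- A child of a cone through `R` is a cone after the move. [cite: Blanco2012a, Def. 1.22] -/
theorem child_mem_move_cones {s : MGame ι} {R : Finset ℕ} (ρ : ℕ) {C : Finset ℕ} (hC : C ∈ s.cones)
    (hRC : R ⊆ C) {x : ℕ} (hx : x ∈ R) : insert ρ (C.erase x) ∈ (s.move R ρ).cones :=
  mem_move_cones.mpr (Or.inr ⟨C, hC, hRC, x, hx, rfl⟩)

/-- Sum over a child cone: `Σ_{C − x + ρ} f = Σ_C f − f x + f ρ` (for `x ∈ C`, `ρ ∉ C`) — the chart formula behind the
transform.  [cite: Blanco2012a, Def. 1.22, Rem. 1.23] -/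
theorem sum_insert_erase {β : Type*} [AddCommGroup β] (f : ℕ → β) {C : Finset ℕ} {x ρ : ℕ}
    (hx : x ∈ C) (hρ : ρ ∉ C) : ∑ r ∈ insert ρ (C.erase x), f r = (∑ r ∈ C, f r) - f x + f ρ := by
  have hρ' : ρ ∉ C.erase x := fun h => hρ (Finset.mem_of_mem_erase h)
  rw [Finset.sum_insert hρ', Finset.sum_erase_eq_sub hx]
  abel

/-- A child cone has as many rays as its parent (the blow-up of a regular chart is covered by regular charts of the
same dimension).  [cite: Blanco2012a, Def. 1.22, Rem. 1.23] -/
theorem card_insert_erase {C : Finset ℕ} {x ρ : ℕ} (hx : x ∈ C) (hρ : ρ ∉ C) :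
    (insert ρ (C.erase x)).card = C.card := by
  have hρ' : ρ ∉ C.erase x := fun h => hρ (Finset.mem_of_mem_erase h)
  rw [Finset.card_insert_of_notMem hρ', Finset.card_erase_of_mem hx]
  have := Finset.card_pos.mpr ⟨x, hx⟩
  omega

/-- THE ONE-STEP LAW on face sums: the child `C − x + ρ` of a cone `C ⊇ R ∋ x` has, for every generator,
`Σ_{child} = Σ_C − expo x + (Σ_R − 1)` — Hironaka's move `σ_{R,x}` on the corner's exponents.
[cite: EncinasVillamayor1998, Def. 1.4] -/
theorem fsum_child (s : MGame ι) {R C : Finset ℕ} {x ρ : ℕ} (hx : x ∈ C) (hρ : ρ ∉ C) (v : ι) :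
    (s.move R ρ).fsum (insert ρ (C.erase x)) v = s.fsum C v - s.expo x v + (s.fsum R v - 1) := by
  unfold fsum
  rw [sum_insert_erase (fun r => (s.move R ρ).expo r v) hx hρ, expo_move_self]
  have h1 : ∑ r ∈ C, (s.move R ρ).expo r v = ∑ r ∈ C, s.expo r v :=
    Finset.sum_congr rfl (fun r hr => expo_move_of_ne s R (ne_of_mem_of_not_mem hr hρ) v)
  have h2 : (s.move R ρ).expo x v = s.expo x v := expo_move_of_ne s R (ne_of_mem_of_not_mem hx hρ) v
  rw [h1, h2, fsum_def]

/-- A done cone contains no legal face (exponents non-negative): `Σ_R ≤ Σ_C < 1` for the winning generator.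
[cite: Blanco2012a, Def. 1.18, Def. 1.24] -/
theorem not_legal_of_done {s : MGame ι} {C R : Finset ℕ} (hRC : R ⊆ C)
    (hnn : ∀ r ∈ C, ∀ v, 0 ≤ s.expo r v) (hC : s.Done C) : ¬ ∀ v, (1 : ℚ) ≤ s.fsum R v := by
  intro h
  obtain ⟨v, hv⟩ := hC
  have h1 := h v
  have h2 : s.fsum R v ≤ s.fsum C v :=
    Finset.sum_le_sum_of_subset_of_nonneg hRC (fun r hr _ => hnn r hr v)
  linarith

/-- Hence a legal face is never contained in a done cone of a well-formed state.
[cite: Blanco2012a, Def. 1.18, Def. 1.24] -/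
theorem not_done_of_legal_subset {n : ℕ} {s : MGame ι} (hW : s.WF n) {R C : Finset ℕ} (hC : C ∈ s.cones)
    (hRC : R ⊆ C) (hR : s.Legal R) : ¬ s.Done C :=
  fun hd => not_legal_of_done hRC (hW.nonneg C hC) hd hR.2.2

end Basic

/-! ## §2 Invariants along a legal move with a fresh name -/

section Invariants

variable {n : ℕ}

/-- A fresh name is not a ray of any cone. [cite: Blanco2012a, Rem. 1.23] -/
theorem not_mem_of_fresh {s : MGame ι} (hW : s.WF n) {ρ : ℕ} (hρ : s.Fresh ρ) {C : Finset ℕ}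
    (hC : C ∈ s.cones) : ρ ∉ C :=
  fun h => hρ (hW.subset_used C hC h)

/-- Well-formedness is preserved by a legal move with a fresh name (the new exponents `Σ_R − 1` are `≥ 0` by
legality).  [cite: Blanco2012a, Def. 1.22] -/
theorem WF.move {s : MGame ι} (hW : s.WF n) {R : Finset ℕ} (hR : s.Legal R) {ρ : ℕ} (hρ : s.Fresh ρ) :
    (s.move R ρ).WF n := by
  obtain ⟨C₀, hC₀, hRC₀⟩ := hR.2.1
  have hρR : ρ ∉ R := fun h => not_mem_of_fresh hW hρ hC₀ (hRC₀ h)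
  refine ⟨fun D hD => ?_, fun D hD => ?_, fun D hD r hr v => ?_⟩
  · rcases mem_move_cones.mp hD with ⟨hD, -⟩ | ⟨C, hC, hRC, x, hx, rfl⟩
    · exact hW.card_eq D hD
    · rw [card_insert_erase (hRC hx) (not_mem_of_fresh hW hρ hC)]
      exact hW.card_eq C hC
  · rcases mem_move_cones.mp hD with ⟨hD, -⟩ | ⟨C, hC, hRC, x, hx, rfl⟩
    · exact (hW.subset_used D hD).trans (Finset.subset_insert _ _)
    · intro r hr
      rw [used_move]
      rcases Finset.mem_insert.mp hr with rfl | hr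
      · exact Finset.mem_insert_self _ _
      · exact Finset.mem_insert_of_mem (hW.subset_used C hC (Finset.mem_of_mem_erase hr))
  · rcases mem_move_cones.mp hD with ⟨hD, -⟩ | ⟨C, hC, hRC, x, hx, rfl⟩
    · rw [expo_move_of_ne s R (ne_of_mem_of_not_mem hr (not_mem_of_fresh hW hρ hD))]
      exact hW.nonneg D hD r hr v
    · rcases Finset.mem_insert.mp hr with rfl | hr'
      · rw [expo_move_self]
        linarith [hR.2.2 v]
      · have hrC : r ∈ C := Finset.mem_of_mem_erase hr'
        rw [expo_move_of_ne s R (ne_of_mem_of_not_mem hrC (not_mem_of_fresh hW hρ hC))]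
        exact hW.nonneg C hC r hrC v

/-- Common denominators are preserved by moves. [cite: Blanco2012a, Def. 1.22] -/
theorem IsLattice.move {N : ℕ} {s : MGame ι} (hW : s.WF n) (hL : s.IsLattice N) {R : Finset ℕ}
    (hR : s.Legal R) {ρ : ℕ} (hρ : s.Fresh ρ) : (s.move R ρ).IsLattice N := by
  classical
  obtain ⟨C₀, hC₀, hRC₀⟩ := hR.2.1
  intro D hD r hr v
  rcases mem_move_cones.mp hD with ⟨hD, -⟩ | ⟨C, hC, hRC, x, hx, rfl⟩
  · rw [expo_move_of_ne s R (ne_of_mem_of_not_mem hr (not_mem_of_fresh hW hρ hD))]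
    exact hL D hD r hr v
  · rcases Finset.mem_insert.mp hr with rfl | hr'
    · rw [expo_move_self]
      -- Σ_R expo − 1 with each summand of denominator N
      have key : ∀ T : Finset ℕ, T ⊆ C₀ → ∃ z : ℤ, s.fsum T v = z / N := by
        intro T hT
        induction T using Finset.induction_on with
        | empty => exact ⟨0, by simp [fsum]⟩
        | insert a T ha ih =>
          obtain ⟨z, hz⟩ := ih (fun t ht => hT (Finset.mem_insert_of_mem ht))
          obtain ⟨w, hw⟩ := hL C₀ hC₀ a (hT (Finset.mem_insert_self _ _)) v
          refine ⟨w + z, ?_⟩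
          unfold fsum at hz ⊢
          rw [Finset.sum_insert ha, hw, hz]
          push_cast
          ring
      obtain ⟨z, hz⟩ := key R hRC₀
      by_cases hN : N = 0
      · subst hN
        refine ⟨0, ?_⟩
        simp only [CharP.cast_eq_zero, div_zero] at hz ⊢
        -- with N = 0 every lattice value is 0, so Σ_R = 0 contradicts legality unless … ; use hz
        have := hR.2.2 v
        rw [hz] at this
        linarith
      · refine ⟨z - N, ?_⟩
        rw [hz]
        have hN' : (N : ℚ) ≠ 0 := by exact_mod_cast hN
        field_simp
        push_cast
        ring
    · have hrC : r ∈ C := Finset.mem_of_mem_erase hr'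
      rw [expo_move_of_ne s R (ne_of_mem_of_not_mem hrC (not_mem_of_fresh hW hρ hC))]
      exact hL C hC r hrC v

/-- DONE CONES STAY: a done cone of a well-formed state is still a cone, and still done, after any legal move
(it contains no legal face, so it is untouched).  [cite: Blanco2012a, Def. 1.24] -/
theorem done_persists {s : MGame ι} (hW : s.WF n) {R : Finset ℕ} (hR : s.Legal R) {ρ : ℕ} (hρ : s.Fresh ρ)
    {C : Finset ℕ} (hC : C ∈ s.cones) (hd : s.Done C) :
    C ∈ (s.move R ρ).cones ∧ (s.move R ρ).Done C := by
  have hRC : ¬ R ⊆ C := fun h => not_done_of_legal_subset hW hC h hR hd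
  refine ⟨mem_move_cones_of_not_subset ρ hC hRC, ?_⟩
  obtain ⟨v, hv⟩ := hd
  exact ⟨v, by rwa [fsum_move_of_not_mem s R (not_mem_of_fresh hW hρ hC)]⟩

/-- Every state has a common denominator (finitely many rational exponents) — the bounded denominators of the
rational polyhedra game.  [cite: Spivakovsky1983, §III (closing argument: bounded denominators)] -/
theorem exists_isLattice [Fintype ι] {s : MGame ι} : ∃ N : ℕ, 0 < N ∧ s.IsLattice N := by
  classical
  -- the product of all denominators occurring
  let vals : Finset ℚ := (s.cones.biUnion id ×ˢ (Finset.univ : Finset ι)).image (fun p => s.expo p.1 p.2)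
  refine ⟨∏ q ∈ vals, q.den, Finset.prod_pos (fun q _ => q.den_pos), fun C hC r hr v => ?_⟩
  have hmem : s.expo r v ∈ vals :=
    Finset.mem_image.mpr ⟨(r, v), Finset.mem_product.mpr ⟨Finset.mem_biUnion.mpr ⟨C, hC, hr⟩,
      Finset.mem_univ _⟩, rfl⟩
  obtain ⟨k, hk⟩ : (s.expo r v).den ∣ ∏ q ∈ vals, q.den := Finset.dvd_prod_of_mem _ hmem
  refine ⟨(s.expo r v).num * k, ?_⟩
  rw [hk]
  push_cast
  have hden : ((s.expo r v).den : ℚ) ≠ 0 := by exact_mod_cast (s.expo r v).den_pos.ne'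
  have hk0 : (k : ℚ) ≠ 0 := by
    intro h0
    have : (k : ℕ) = 0 := by exact_mod_cast h0
    subst this
    simp at hk
    exact absurd hk (Finset.prod_ne_zero_iff.mpr (fun q _ => q.den_pos.ne'))
  rw [mul_div_mul_right _ _ hk0]
  exact (Rat.num_div_den (s.expo r v)).symm

end Invariants

/-! ## §3 The Encinas–Villamayor bookkeeping `J = M · I` without history

Relative to the set `OLD` of names present when the argument starts (all of them count as non-exceptional:
`H` is reset to `∅`, [Blanco2012a, Def. 1.22 with Thm. 4.6 B)]): a ray created LATER carries the monomial
(exceptional) part `α_r = min_v expo r v` and the residual part `p_r(v) = expo r v − α_r`; an old ray has `α_r = 0`.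
This is the factorisation `J_i = M_i · I_i`, `M_i` supported on the exceptional divisors, of [Blanco2012a, Alg. 4.4
step 1] — recovered from the state alone.  `theta R = min_v Σ_R p(v)` is the order of the residual part `I` along the
stratum of `R` ([Blanco2012a, Alg. 4.4 step 2: `max E-ord(I_i)`]). -/

section Bookkeeping

variable [Fintype ι] [Nonempty ι]

/-- `β_r = min_v expo r v`: the full monomial factor through the divisor of `r`. [cite: Blanco2012a, Alg. 4.4 (step 1)] -/
def beta (s : MGame ι) (r : ℕ) : ℚ := Finset.univ.inf' Finset.univ_nonempty (fun v => s.expo r v)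

/-- `α_r`: exponent of the exceptional monomial part `M` at the divisor of `r` — `0` on the rays of `OLD`, `β_r` on the
rays created since.  [cite: Blanco2012a, Alg. 4.4 (step 1)] -/
def alpha (OLD : Finset ℕ) (s : MGame ι) (r : ℕ) : ℚ := if r ∈ OLD then 0 else s.beta r

/-- `p_r(v) = expo r v − α_r`: exponents of the residual (non-monomial) factor `I`. [cite: Blanco2012a, Alg. 4.4 (step 1)] -/
def pexp (OLD : Finset ℕ) (s : MGame ι) (r : ℕ) (v : ι) : ℚ := s.expo r v - s.alpha OLD r

/-- `Σ_{r∈R} α_r`: order of `M` along the stratum of `R`. [cite: Blanco2012a, Alg. 4.4 (step 1)] -/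
def asum (OLD : Finset ℕ) (s : MGame ι) (R : Finset ℕ) : ℚ := ∑ r ∈ R, s.alpha OLD r

/-- `Σ_{r∈R} p_r(v)`: order of the `v`-th residual generator along the stratum of `R`. [cite: Blanco2012a, Alg. 4.4 (step 2)] -/
def psum (OLD : Finset ℕ) (s : MGame ι) (R : Finset ℕ) (v : ι) : ℚ := ∑ r ∈ R, s.pexp OLD r v

/-- `θ_R = min_v Σ_R p(v)`: the E-order of the residual factor `I` along the stratum of `R`.
[cite: Blanco2012a, Alg. 4.4 (step 2), Def. 3.20] -/
def theta (OLD : Finset ℕ) (s : MGame ι) (R : Finset ℕ) : ℚ :=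
  Finset.univ.inf' Finset.univ_nonempty (fun v => s.psum OLD R v)

variable (OLD : Finset ℕ)

/-- `β_r ≤ expo r v`. [cite: Blanco2012a, Alg. 4.4 (step 1)] -/
theorem beta_le (s : MGame ι) (r : ℕ) (v : ι) : s.beta r ≤ s.expo r v :=
  Finset.inf'_le _ (Finset.mem_univ v)

/-- `β_r` is attained by some generator. [cite: Blanco2012a, Alg. 4.4 (step 1)] -/
theorem exists_beta_eq (s : MGame ι) (r : ℕ) : ∃ v, s.beta r = s.expo r v := by
  obtain ⟨v, -, hv⟩ := Finset.exists_mem_eq_inf' Finset.univ_nonempty (fun v => s.expo r v)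
  exact ⟨v, hv⟩

/-- `θ_R ≤ Σ_R p(v)`. [cite: Blanco2012a, Alg. 4.4 (step 2)] -/
theorem theta_le_psum (s : MGame ι) (R : Finset ℕ) (v : ι) : s.theta OLD R ≤ s.psum OLD R v :=
  Finset.inf'_le _ (Finset.mem_univ v)

/-- `θ_R` is attained by some (minimising) generator. [cite: Blanco2012a, Alg. 4.4 (step 2)] -/
theorem exists_theta_eq (s : MGame ι) (R : Finset ℕ) : ∃ v, s.psum OLD R v = s.theta OLD R := by
  obtain ⟨v, -, hv⟩ := Finset.exists_mem_eq_inf' Finset.univ_nonempty (fun v => s.psum OLD R v)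
  exact ⟨v, hv.symm⟩

/-- `c ≤ θ_R` iff `c ≤ Σ_R p(v)` for every generator. [cite: Blanco2012a, Alg. 4.4 (step 2)] -/
theorem le_theta_iff (s : MGame ι) (R : Finset ℕ) (c : ℚ) :
    c ≤ s.theta OLD R ↔ ∀ v, c ≤ s.psum OLD R v := by
  unfold theta
  rw [Finset.le_inf'_iff]
  simp

/-- `expo = α + p`. [cite: Blanco2012a, Alg. 4.4 (step 1)] -/
theorem expo_eq_alpha_add_pexp (s : MGame ι) (r : ℕ) (v : ι) : s.expo r v = s.alpha OLD r + s.pexp OLD r v := by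
  unfold pexp; ring

/-- `Σ_R expo(v) = Σ_R α + Σ_R p(v)`. [cite: Blanco2012a, Alg. 4.4 (step 1)] -/
theorem fsum_eq_asum_add_psum (s : MGame ι) (R : Finset ℕ) (v : ι) :
    s.fsum R v = s.asum OLD R + s.psum OLD R v := by
  unfold fsum asum psum pexp
  rw [← Finset.sum_add_distrib]
  exact Finset.sum_congr rfl (fun r _ => by ring)

/-- On rays with non-negative exponents, `α_r ≥ 0`. [cite: Blanco2012a, Alg. 4.4 (step 1)] -/
theorem alpha_nonneg (s : MGame ι) {r : ℕ} (h : ∀ v, 0 ≤ s.expo r v) : 0 ≤ s.alpha OLD r := by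
  unfold alpha
  split_ifs
  · exact le_rfl
  · obtain ⟨v, hv⟩ := s.exists_beta_eq r
    rw [hv]; exact h v

/-- `p_r(v) ≥ 0` (since `α_r ≤ β_r ≤ expo r v`, and `α_r = 0 ≤ expo r v` on old rays). [cite: Blanco2012a, Alg. 4.4 (step 1)] -/
theorem pexp_nonneg (s : MGame ι) {r : ℕ} (h : ∀ v, 0 ≤ s.expo r v) (v : ι) : 0 ≤ s.pexp OLD r v := by
  unfold pexp alpha
  split_ifs
  · simpa using h v
  · linarith [s.beta_le r v]

/-- Some generator has `p_r(v) = 0` on a NEW ray (`min_v p_r(v) = 0`). [cite: Blanco2012a, Alg. 4.4 (step 1)] -/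
theorem exists_pexp_eq_zero (s : MGame ι) {r : ℕ} (hr : r ∉ OLD) : ∃ v, s.pexp OLD r v = 0 := by
  obtain ⟨v, hv⟩ := s.exists_beta_eq r
  exact ⟨v, by simp [pexp, alpha, hr, hv]⟩

/-- Residual sums are non-negative. [cite: Blanco2012a, Alg. 4.4 (step 1)] -/
theorem psum_nonneg (s : MGame ι) {R : Finset ℕ} (h : ∀ r ∈ R, ∀ v, 0 ≤ s.expo r v) (v : ι) :
    0 ≤ s.psum OLD R v :=
  Finset.sum_nonneg (fun r hr => s.pexp_nonneg OLD (h r hr) v)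

/-- Monomial sums are non-negative. [cite: Blanco2012a, Alg. 4.4 (step 1)] -/
theorem asum_nonneg (s : MGame ι) {R : Finset ℕ} (h : ∀ r ∈ R, ∀ v, 0 ≤ s.expo r v) : 0 ≤ s.asum OLD R :=
  Finset.sum_nonneg (fun r hr => s.alpha_nonneg OLD (h r hr))

/-- `θ_R ≥ 0`. [cite: Blanco2012a, Alg. 4.4 (step 2)] -/
theorem theta_nonneg (s : MGame ι) {R : Finset ℕ} (h : ∀ r ∈ R, ∀ v, 0 ≤ s.expo r v) : 0 ≤ s.theta OLD R :=
  (s.le_theta_iff OLD R 0).mpr (fun v => s.psum_nonneg OLD h v)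

/-- Monotonicity of the residual sums in the face. [cite: Blanco2012a, Alg. 4.4 (step 2)] -/
theorem psum_le_psum_of_subset (s : MGame ι) {R D : Finset ℕ} (hRD : R ⊆ D)
    (h : ∀ r ∈ D, ∀ v, 0 ≤ s.expo r v) (v : ι) : s.psum OLD R v ≤ s.psum OLD D v :=
  Finset.sum_le_sum_of_subset_of_nonneg hRD (fun r hr _ => s.pexp_nonneg OLD (h r hr) v)

/-- Monomial sums are monotone in the face. [cite: Blanco2012a, Alg. 4.4 (step 1)] -/
theorem asum_le_asum_of_subset (s : MGame ι) {R D : Finset ℕ} (hRD : R ⊆ D)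
    (h : ∀ r ∈ D, ∀ v, 0 ≤ s.expo r v) : s.asum OLD R ≤ s.asum OLD D :=
  Finset.sum_le_sum_of_subset_of_nonneg hRD (fun r hr _ => s.alpha_nonneg OLD (h r hr))

/-- `θ` is monotone in the face: `θ_R ≤ θ_D` for `R ⊆ D`. [cite: Blanco2012a, Alg. 4.4 (step 2)] -/
theorem theta_le_theta_of_subset (s : MGame ι) {R D : Finset ℕ} (hRD : R ⊆ D)
    (h : ∀ r ∈ D, ∀ v, 0 ≤ s.expo r v) : s.theta OLD R ≤ s.theta OLD D := by
  rw [le_theta_iff]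
  intro v
  exact (s.theta_le_psum OLD R v).trans (s.psum_le_psum_of_subset OLD hRD h v)

/-- `Σ_R α ≤ Σ_R expo(v)`: the monomial part divides every generator. [cite: Blanco2012a, Alg. 4.4 (step 1)] -/
theorem asum_le_fsum (s : MGame ι) (R : Finset ℕ) (h : ∀ r ∈ R, ∀ v, 0 ≤ s.expo r v) (v : ι) :
    s.asum OLD R ≤ s.fsum R v := by
  rw [s.fsum_eq_asum_add_psum OLD]
  linarith [s.psum_nonneg OLD h v]

/-! ### The bookkeeping along a move -/

variable {OLD}

/-- `β` of old names is unchanged by a move. [cite: Blanco2012a, Def. 1.22] -/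
theorem beta_move_of_ne (s : MGame ι) (R : Finset ℕ) {ρ r : ℕ} (h : r ≠ ρ) :
    (s.move R ρ).beta r = s.beta r := by
  unfold beta
  simp only [expo_move_of_ne s R h]

/-- `α` of old names is unchanged by a move. [cite: Blanco2012a, Def. 1.22] -/
theorem alpha_move_of_ne (s : MGame ι) (R : Finset ℕ) {ρ r : ℕ} (h : r ≠ ρ) :
    (s.move R ρ).alpha OLD r = s.alpha OLD r := by
  unfold alpha; rw [beta_move_of_ne s R h]

/-- `p` of old names is unchanged by a move. [cite: Blanco2012a, Def. 1.22] -/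
theorem pexp_move_of_ne (s : MGame ι) (R : Finset ℕ) {ρ r : ℕ} (h : r ≠ ρ) (v : ι) :
    (s.move R ρ).pexp OLD r v = s.pexp OLD r v := by
  unfold pexp; rw [expo_move_of_ne s R h, alpha_move_of_ne s R h]

/-- Monomial sums of faces avoiding the new name are unchanged. [cite: Blanco2012a, Def. 1.22] -/
theorem asum_move_of_not_mem (s : MGame ι) (R : Finset ℕ) {ρ : ℕ} {T : Finset ℕ} (h : ρ ∉ T) :
    (s.move R ρ).asum OLD T = s.asum OLD T :=
  Finset.sum_congr rfl (fun _ hr => alpha_move_of_ne s R (ne_of_mem_of_not_mem hr h))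

/-- Residual sums of faces avoiding the new name are unchanged. [cite: Blanco2012a, Def. 1.22] -/
theorem psum_move_of_not_mem (s : MGame ι) (R : Finset ℕ) {ρ : ℕ} {T : Finset ℕ} (h : ρ ∉ T) (v : ι) :
    (s.move R ρ).psum OLD T v = s.psum OLD T v :=
  Finset.sum_congr rfl (fun _ hr => pexp_move_of_ne s R (ne_of_mem_of_not_mem hr h) v)

/-- `θ` of faces avoiding the new name is unchanged. [cite: Blanco2012a, Def. 1.22] -/
theorem theta_move_of_not_mem (s : MGame ι) (R : Finset ℕ) {ρ : ℕ} {T : Finset ℕ} (h : ρ ∉ T) :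
    (s.move R ρ).theta OLD T = s.theta OLD T := by
  unfold theta
  simp only [psum_move_of_not_mem s R h]

/-- A constant slides out of a finite minimum. [folklore] -/
private theorem inf'_const_add {α : Type*} (t : Finset α) (ht : t.Nonempty) (c : ℚ) (f : α → ℚ) :
    t.inf' ht (fun a => c + f a) = c + t.inf' ht f := by
  apply le_antisymm
  · obtain ⟨a, ha, hfa⟩ := Finset.exists_mem_eq_inf' ht f
    rw [hfa]
    exact Finset.inf'_le _ ha
  · rw [Finset.le_inf'_iff]
    intro a ha
    have := Finset.inf'_le f ha
    linarith

/-- THE NEW RAY'S MONOMIAL PART: `β_ρ = Σ_R α + θ_R − 1` (the order of `M · I(Y′)^{θ−c}` along the new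
exceptional divisor).  [cite: Blanco2012a, Def. 1.22, Prop. 3.28] -/
theorem beta_move_self (s : MGame ι) (R : Finset ℕ) (ρ : ℕ) :
    (s.move R ρ).beta ρ = s.asum OLD R + s.theta OLD R - 1 := by
  unfold beta theta
  have h1 : (fun v => (s.move R ρ).expo ρ v) = fun v => (s.asum OLD R - 1) + s.psum OLD R v := by
    funext v
    rw [expo_move_self, s.fsum_eq_asum_add_psum OLD]
    ring
  rw [h1, inf'_const_add]
  ring

/-- THE NEW RAY'S `α`: `α_ρ = Σ_R α + θ_R − 1`. [cite: Blanco2012a, Def. 1.22, Prop. 3.28] -/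
theorem alpha_move_self (s : MGame ι) (R : Finset ℕ) {ρ : ℕ} (hρO : ρ ∉ OLD) :
    (s.move R ρ).alpha OLD ρ = s.asum OLD R + s.theta OLD R - 1 := by
  unfold alpha; rw [if_neg hρO, beta_move_self s R ρ]

/-- THE NEW RAY'S RESIDUAL PART: `p_ρ(v) = Σ_R p(v) − θ_R` (weak transform of `I`). [cite: Blanco2012a, Prop. 3.28] -/
theorem pexp_move_self (s : MGame ι) (R : Finset ℕ) {ρ : ℕ} (hρO : ρ ∉ OLD) (v : ι) :
    (s.move R ρ).pexp OLD ρ v = s.psum OLD R v - s.theta OLD R := by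
  unfold pexp
  rw [expo_move_self, alpha_move_self s R hρO, s.fsum_eq_asum_add_psum OLD]
  ring

/-- Residual sums of a child: `Σ_{C−x+ρ} p′(v) = Σ_C p(v) − p_x(v) + (Σ_R p(v) − θ_R)`.
[cite: Blanco2012a, Prop. 3.28] -/
theorem psum_child (s : MGame ι) {R C : Finset ℕ} {x ρ : ℕ} (hx : x ∈ C) (hρC : ρ ∉ C)
    (hρO : ρ ∉ OLD) (v : ι) :
    (s.move R ρ).psum OLD (insert ρ (C.erase x)) v =
      s.psum OLD C v - s.pexp OLD x v + (s.psum OLD R v - s.theta OLD R) := by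
  unfold psum
  rw [sum_insert_erase (fun r => (s.move R ρ).pexp OLD r v) hx hρC, pexp_move_self s R hρO]
  have h1 : ∑ r ∈ C, (s.move R ρ).pexp OLD r v = ∑ r ∈ C, s.pexp OLD r v :=
    Finset.sum_congr rfl (fun r hr => pexp_move_of_ne s R (ne_of_mem_of_not_mem hr hρC) v)
  rw [h1, pexp_move_of_ne s R (ne_of_mem_of_not_mem hx hρC)]
  rfl

/-- Monomial sums of a child: `Σ_{C−x+ρ} α′ = Σ_C α − α_x + (Σ_R α + θ_R − 1)`. [cite: Blanco2012a, Prop. 3.28] -/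
theorem asum_child (s : MGame ι) {R C : Finset ℕ} {x ρ : ℕ} (hx : x ∈ C) (hρC : ρ ∉ C)
    (hρO : ρ ∉ OLD) :
    (s.move R ρ).asum OLD (insert ρ (C.erase x)) =
      s.asum OLD C - s.alpha OLD x + (s.asum OLD R + s.theta OLD R - 1) := by
  unfold asum
  rw [sum_insert_erase (fun r => (s.move R ρ).alpha OLD r) hx hρC, alpha_move_self s R hρO]
  have h1 : ∑ r ∈ C, (s.move R ρ).alpha OLD r = ∑ r ∈ C, s.alpha OLD r :=
    Finset.sum_congr rfl (fun r hr => alpha_move_of_ne s R (ne_of_mem_of_not_mem hr hρC))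
  rw [h1, alpha_move_of_ne s R (ne_of_mem_of_not_mem hx hρC)]
  rfl

end Bookkeeping

/-! ## §4 Phase facts: allowed centres do not raise the residual order; contact rays

With `θ` the current maximal residual order among not-done cones, a legal centre `R` with `θ_R = θ` lies only in
cones of residual order exactly `θ` and its children have residual order `≤ θ` ([Blanco2012a, Prop. 3.28]: the
E-order of the weak transform does not go up); every such centre through a cone `D` contains the CONTACT SET of `D`
(the rays where some minimising generator of `D` is positive) — the combinatorial face of E-maximal contact
([Blanco2012a, §3.3, Alg. 4.4 step 3]). -/

section Phase

variable [Fintype ι] [Nonempty ι] {OLD : Finset ℕ}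

/-- For a cone `D ⊇ R` with `θ_R = θ_D`, every minimiser `v*` of `D` has `Σ_R p(v*) = θ_D` (all of `p(v*)` on `D` sits
on `R`).  [cite: Blanco2012a, Prop. 3.28] -/
theorem psum_eq_theta_of_minimizer (s : MGame ι) {R D : Finset ℕ} (hRD : R ⊆ D)
    (h : ∀ r ∈ D, ∀ v, 0 ≤ s.expo r v) (hθ : s.theta OLD R = s.theta OLD D) {v : ι}
    (hv : s.psum OLD D v = s.theta OLD D) : s.psum OLD R v = s.theta OLD D := by
  apply le_antisymm
  · rw [← hv]; exact s.psum_le_psum_of_subset OLD hRD h v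
  · rw [← hθ]; exact s.theta_le_psum OLD R v

/-- THE WEAK TRANSFORM DOES NOT RAISE THE ORDER: for a cone `C ⊇ R ∋ x` with `θ_R = θ_C`, the child `C − x + ρ` has
`Σ p′(v*) = θ_C − p_x(v*)` for every minimiser `v*` of `C`, hence residual order `≤ θ_C`.
[cite: Blanco2012a, Prop. 3.28] -/
theorem psum_child_of_minimizer (s : MGame ι) {R C : Finset ℕ} {x ρ : ℕ} (hRC : R ⊆ C) (hx : x ∈ C)
    (hρC : ρ ∉ C) (hρO : ρ ∉ OLD) (h : ∀ r ∈ C, ∀ v, 0 ≤ s.expo r v)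
    (hθ : s.theta OLD R = s.theta OLD C) {v : ι} (hv : s.psum OLD C v = s.theta OLD C) :
    (s.move R ρ).psum OLD (insert ρ (C.erase x)) v = s.theta OLD C - s.pexp OLD x v := by
  rw [psum_child s hx hρC hρO, hv, s.psum_eq_theta_of_minimizer hRC h hθ hv, hθ]
  ring

/-- The residual order of a child of a cone `C ⊇ R` with `θ_R = θ_C` is `≤ θ_C`. [cite: Blanco2012a, Prop. 3.28] -/
theorem theta_child_le (s : MGame ι) {R C : Finset ℕ} {x ρ : ℕ} (hRC : R ⊆ C) (hx : x ∈ C)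
    (hρC : ρ ∉ C) (hρO : ρ ∉ OLD) (h : ∀ r ∈ C, ∀ v, 0 ≤ s.expo r v)
    (hθ : s.theta OLD R = s.theta OLD C) :
    (s.move R ρ).theta OLD (insert ρ (C.erase x)) ≤ s.theta OLD C := by
  obtain ⟨v, hv⟩ := s.exists_theta_eq OLD C
  calc (s.move R ρ).theta OLD (insert ρ (C.erase x))
      ≤ (s.move R ρ).psum OLD (insert ρ (C.erase x)) v := (s.move R ρ).theta_le_psum OLD _ v
    _ = s.theta OLD C - s.pexp OLD x v := s.psum_child_of_minimizer hRC hx hρC hρO h hθ hv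
    _ ≤ s.theta OLD C := by linarith [s.pexp_nonneg OLD (h x hx) v]

/-- `r` is a CONTACT RAY of the cone `D`: some minimising generator of `D` is positive at `r` (the divisor of `r` is a
hypersurface of E-maximal contact for the residual pair at the corner).  [cite: Blanco2012a, §3.3, Alg. 4.4 (step 3)] -/
def IsContact (OLD : Finset ℕ) (s : MGame ι) (D : Finset ℕ) (r : ℕ) : Prop :=
  r ∈ D ∧ ∃ v, s.psum OLD D v = s.theta OLD D ∧ 0 < s.pexp OLD r v

/-- A cone of POSITIVE residual order has a contact ray. [cite: Blanco2012a, §3.3] -/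
theorem exists_isContact (s : MGame ι) {D : Finset ℕ} (hθ : 0 < s.theta OLD D) :
    ∃ r, s.IsContact OLD D r := by
  obtain ⟨v, hv⟩ := s.exists_theta_eq OLD D
  have : ∃ r ∈ D, 0 < s.pexp OLD r v := by
    by_contra hcon
    push Not at hcon
    have : s.psum OLD D v ≤ 0 := Finset.sum_nonpos (fun r hr => hcon r hr)
    linarith
  obtain ⟨r, hr, hpos⟩ := this
  exact ⟨r, hr, v, hv, hpos⟩

/-- MAXIMAL CONTACT: a centre `R ⊆ D` with `θ_R = θ_D` contains every contact ray of `D`.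
[cite: Blanco2012a, §3.3 (E-maximal contact), Alg. 4.4 (step 3)] -/
theorem IsContact.mem_of_theta_eq {s : MGame ι} {D R : Finset ℕ} {r : ℕ} (hr : s.IsContact OLD D r)
    (hRD : R ⊆ D) (h : ∀ r ∈ D, ∀ v, 0 ≤ s.expo r v) (hθ : s.theta OLD R = s.theta OLD D) : r ∈ R := by
  obtain ⟨hrD, v, hv, hpos⟩ := hr
  by_contra hrR
  have hsplit : s.psum OLD D v = s.psum OLD R v + s.psum OLD (D \ R) v := by
    unfold psum
    rw [← Finset.sum_union (Finset.disjoint_sdiff), Finset.union_sdiff_of_subset hRD]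
  have hR : s.psum OLD R v = s.theta OLD D := s.psum_eq_theta_of_minimizer hRD h hθ hv
  have hrest : s.pexp OLD r v ≤ s.psum OLD (D \ R) v :=
    Finset.single_le_sum (fun t ht => s.pexp_nonneg OLD (h t (Finset.mem_sdiff.mp ht).1) v)
      (Finset.mem_sdiff.mpr ⟨hrD, hrR⟩)
  linarith

/-- The child through a contact ray DROPS: `θ(D − r + ρ) < θ_D` when `r` is a contact ray of `D` and `θ_R = θ_D`.
[cite: Blanco2012a, §3.3, Prop. 3.13] -/
theorem IsContact.theta_child_lt {s : MGame ι} {D R : Finset ℕ} {r ρ : ℕ} (hr : s.IsContact OLD D r)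
    (hRD : R ⊆ D) (hρD : ρ ∉ D) (hρO : ρ ∉ OLD) (h : ∀ t ∈ D, ∀ v, 0 ≤ s.expo t v)
    (hθ : s.theta OLD R = s.theta OLD D) :
    (s.move R ρ).theta OLD (insert ρ (D.erase r)) < s.theta OLD D := by
  obtain ⟨hrD, v, hv, hpos⟩ := hr
  calc (s.move R ρ).theta OLD (insert ρ (D.erase r))
      ≤ (s.move R ρ).psum OLD (insert ρ (D.erase r)) v := (s.move R ρ).theta_le_psum OLD _ v
    _ = s.theta OLD D - s.pexp OLD r v := s.psum_child_of_minimizer hRD hrD hρD hρO h hθ hv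
    _ < s.theta OLD D := by linarith

/-- CONTACT IS INHERITED by children of the same residual order: if `θ(D − x + ρ) = θ_D` then every contact ray `r`
of `D` is a ray of the child (i.e. `r ≠ x`) and a contact ray of it.  [cite: Blanco2012a, Prop. 3.13] -/
theorem IsContact.child {s : MGame ι} {D R : Finset ℕ} {r x ρ : ℕ} (hr : s.IsContact OLD D r)
    (hRD : R ⊆ D) (hx : x ∈ D) (hρD : ρ ∉ D) (hρO : ρ ∉ OLD) (h : ∀ t ∈ D, ∀ v, 0 ≤ s.expo t v)
    (hθ : s.theta OLD R = s.theta OLD D)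
    (hsame : (s.move R ρ).theta OLD (insert ρ (D.erase x)) = s.theta OLD D) :
    (s.move R ρ).IsContact OLD (insert ρ (D.erase x)) r := by
  obtain ⟨hrD, v, hv, hpos⟩ := hr
  have hchild := s.psum_child_of_minimizer hRD hx hρD hρO h hθ hv
  have hle : (s.move R ρ).theta OLD (insert ρ (D.erase x)) ≤ (s.move R ρ).psum OLD (insert ρ (D.erase x)) v :=
    (s.move R ρ).theta_le_psum OLD _ v
  have hpx : s.pexp OLD x v = 0 := by
    have := s.pexp_nonneg OLD (h x hx) v
    linarith
  have hrx : r ≠ x := fun hrx => by rw [hrx] at hpos; linarith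
  have hrρ : r ≠ ρ := ne_of_mem_of_not_mem hrD hρD
  refine ⟨Finset.mem_insert_of_mem (Finset.mem_erase.mpr ⟨hrx, hrD⟩), v, ?_, ?_⟩
  · rw [hsame, hchild, hpx, sub_zero]
  · rw [pexp_move_of_ne s R hrρ]; exact hpos

end Phase

/-! ## §5 The monomial phase (Encinas–Villamayor's monomial case, existence form)

When every not-done cone has residual order `0`, at each of them some generator IS the monomial part `M` (all its
residual exponents vanish), so a not-done cone has `Σ_C α ≥ 1`; blowing up an inclusion-minimal face `R` with
`Σ_R α ≥ 1` is legal, creates `α_ρ = Σ_R α − 1 < α_x` for every `x ∈ R`, and replaces every cone through `R` by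
children of strictly smaller `N·Σα`.  The potential `Σ_C (n+1)^{⌊N Σ_C α⌋}` drops, so finitely many such moves end
with every cone done.  This is the sequence «defined in terms of the function Γ … we finally come to a resolution»
of [EncinasVillamayor1998, §2 pp. 115–116], in the freedom-of-choice form sufficient for existence.
-/

section MonomialPhase

variable [Fintype ι] [Nonempty ι] {n N : ℕ} {OLD : Finset ℕ}

/-- Sums of `N`-lattice values are `N`-lattice values. [folklore] -/
private theorem exists_sum_eq_div (N : ℕ) {T : Finset ℕ} (f : ℕ → ℚ) (h : ∀ r ∈ T, ∃ z : ℤ, f r = z / N) :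
    ∃ z : ℤ, ∑ r ∈ T, f r = z / N := by
  classical
  induction T using Finset.induction_on with
  | empty => exact ⟨0, by simp⟩
  | insert a T ha ih =>
    obtain ⟨z, hz⟩ := ih (fun r hr => h r (Finset.mem_insert_of_mem hr))
    obtain ⟨w, hw⟩ := h a (Finset.mem_insert_self _ _)
    refine ⟨w + z, ?_⟩
    rw [Finset.sum_insert ha, hw, hz]
    push_cast
    ring

/-- `α_r` is an `N`-lattice value on rays of cones. [cite: Blanco2012a, Alg. 4.4 (step 1)] -/
theorem exists_alpha_eq_div (s : MGame ι) (hL : s.IsLattice N) {C : Finset ℕ} (hC : C ∈ s.cones) {r : ℕ}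
    (hr : r ∈ C) : ∃ z : ℤ, s.alpha OLD r = z / N := by
  unfold alpha
  split_ifs
  · exact ⟨0, by simp⟩
  · obtain ⟨v, hv⟩ := s.exists_beta_eq r
    obtain ⟨z, hz⟩ := hL C hC r hr v
    exact ⟨z, by rw [hv, hz]⟩

/-- `Σ_T α` is an `N`-lattice value on subfaces of cones. [cite: Blanco2012a, Alg. 4.4 (step 1)] -/
theorem exists_asum_eq_div (s : MGame ι) (hL : s.IsLattice N) {C T : Finset ℕ} (hC : C ∈ s.cones)
    (hT : T ⊆ C) : ∃ z : ℤ, s.asum OLD T = z / N :=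
  exists_sum_eq_div N _ (fun _ hr => s.exists_alpha_eq_div hL hC (hT hr))

/-- A positive difference of `N`-lattice values is at least `1/N`. [folklore] -/
private theorem one_div_le_of_lattice {N : ℕ} (hN : 0 < N) {a b : ℚ} (ha : ∃ z : ℤ, a = z / N) (hb : ∃ z : ℤ, b = z / N)
    (hlt : b < a) : 1 / (N : ℚ) ≤ a - b := by
  obtain ⟨z, rfl⟩ := ha
  obtain ⟨w, rfl⟩ := hb
  have hN' : (0 : ℚ) < N := by exact_mod_cast hN
  rw [← sub_div, div_le_div_iff_of_pos_right hN']
  rw [div_lt_div_iff_of_pos_right hN'] at hlt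
  have : w < z := by exact_mod_cast hlt
  have : w + 1 ≤ z := this
  have : ((w : ℚ) + 1 ≤ z) := by exact_mod_cast this
  linarith

/-- The potential of the monomial phase: `Σ_C (n+1)^{⌊N · Σ_C α⌋}`. [cite: EncinasVillamayor1998, §2 (monomial case)] -/
def mpot (OLD : Finset ℕ) (N n : ℕ) (s : MGame ι) : ℕ :=
  ∑ C ∈ s.cones, (n + 1) ^ ⌊(N : ℚ) * s.asum OLD C⌋₊

/-- Sum over a `biUnion` is at most the double sum (natural-number weights). [folklore] -/
private theorem sum_biUnion_le_nat {κ β : Type*} [DecidableEq β] (t : Finset κ) (g : κ → Finset β) (f : β → ℕ) :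
    ∑ b ∈ t.biUnion g, f b ≤ ∑ a ∈ t, ∑ b ∈ g a, f b := by
  classical
  induction t using Finset.induction_on with
  | empty => simp
  | insert a t ha ih =>
    rw [Finset.biUnion_insert, Finset.sum_insert ha]
    have h1 := Finset.sum_union_inter (s₁ := g a) (s₂ := t.biUnion g) (f := f)
    omega

/-- The hypotheses of the monomial phase, bundled: well-formed of dimension `n`, common denominator `N > 0`, the old
names contain `OLD`, and every not-done cone has residual order `0`. [cite: EncinasVillamayor1998, §2 (monomial case)] -/
structure MonomialPhase (OLD : Finset ℕ) (N n : ℕ) (s : MGame ι) : Prop where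
  wf : s.WF n
  pos : 0 < N
  lattice : s.IsLattice N
  old_sub : OLD ⊆ s.used
  theta_le : ∀ C ∈ s.cones, ¬ s.Done C → s.theta OLD C ≤ 0

/-- In the monomial phase a not-done cone carries monomial order `Σ_C α ≥ 1` (the minimising generator has no
residual part).  [cite: EncinasVillamayor1998, §2 (monomial case)] -/
theorem MonomialPhase.one_le_asum {s : MGame ι} (h : s.MonomialPhase OLD N n) {C : Finset ℕ}
    (hC : C ∈ s.cones) (hd : ¬ s.Done C) : 1 ≤ s.asum OLD C := by
  have hnn := h.wf.nonneg C hC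
  have hθ0 : s.theta OLD C = 0 := le_antisymm (h.theta_le C hC hd) (s.theta_nonneg OLD hnn)
  obtain ⟨v, hv⟩ := s.exists_theta_eq OLD C
  have h1 : (1 : ℚ) ≤ s.fsum C v := by
    by_contra hlt; exact hd ⟨v, lt_of_not_ge hlt⟩
  rw [s.fsum_eq_asum_add_psum OLD, hv, hθ0] at h1
  linarith

/-- ONE STEP OF THE MONOMIAL PHASE: at a state with a not-done cone there is a legal centre `R` (an inclusion-minimal
face of monomial order `≥ 1`, [EncinasVillamayor1998, §2: `Max Γ`]) such that, whatever fresh name is used, the move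
stays in the monomial phase and the potential `mpot` strictly drops. [cite: EncinasVillamayor1998, §2 (monomial case)] -/
theorem MonomialPhase.step {s : MGame ι} (h : s.MonomialPhase OLD N n) {C₀ : Finset ℕ} (hC₀ : C₀ ∈ s.cones)
    (hd₀ : ¬ s.Done C₀) :
    ∃ R, s.Legal R ∧ ∀ ρ, s.Fresh ρ →
      (s.move R ρ).MonomialPhase OLD N n ∧ (s.move R ρ).mpot OLD N n < s.mpot OLD N n := by
  classical
  have hnn₀ := h.wf.nonneg C₀ hC₀
  -- an inclusion-minimal face R ⊆ C₀ with Σ_R α ≥ 1 (minimal cardinality)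
  let S : Finset (Finset ℕ) := C₀.powerset.filter (fun T => 1 ≤ s.asum OLD T)
  have hS : S.Nonempty := ⟨C₀, Finset.mem_filter.mpr ⟨Finset.mem_powerset_self _, h.one_le_asum hC₀ hd₀⟩⟩
  obtain ⟨R, hRS, hRmin⟩ := Finset.exists_min_image S Finset.card hS
  have hRC₀ : R ⊆ C₀ := Finset.mem_powerset.mp (Finset.mem_filter.mp hRS).1
  have hR1 : 1 ≤ s.asum OLD R := (Finset.mem_filter.mp hRS).2
  have hRne : R.Nonempty := by
    rw [Finset.nonempty_iff_ne_empty]; rintro rfl; norm_num [asum] at hR1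
  have hmin : ∀ x ∈ R, s.asum OLD (R.erase x) < 1 := by
    intro x hx
    by_contra hge
    have hmem : R.erase x ∈ S := Finset.mem_filter.mpr
      ⟨Finset.mem_powerset.mpr ((Finset.erase_subset x R).trans hRC₀), le_of_not_gt hge⟩
    have := hRmin _ hmem
    rw [Finset.card_erase_of_mem hx] at this
    have := Finset.card_pos.mpr ⟨x, hx⟩
    omega
  have hLegal : s.Legal R := ⟨hRne, ⟨C₀, hC₀, hRC₀⟩, fun v =>
    hR1.trans (s.asum_le_fsum OLD R (fun r hr => hnn₀ r (hRC₀ hr)) v)⟩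
  -- θ_R = 0
  have hθC₀ : s.theta OLD C₀ = 0 := le_antisymm (h.theta_le C₀ hC₀ hd₀) (s.theta_nonneg OLD hnn₀)
  have hθR : s.theta OLD R = 0 := le_antisymm
    (hθC₀ ▸ s.theta_le_theta_of_subset OLD hRC₀ hnn₀) (s.theta_nonneg OLD (fun r hr => hnn₀ r (hRC₀ hr)))
  refine ⟨R, hLegal, fun ρ hρ => ?_⟩
  have hρO : ρ ∉ OLD := fun hh => hρ (h.old_sub hh)
  have hW' := h.wf.move hLegal hρ
  -- facts about any cone D through R
  have hD_theta : ∀ D ∈ s.cones, R ⊆ D → s.theta OLD D = 0 := fun D hD hRD =>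
    le_antisymm (h.theta_le D hD (not_done_of_legal_subset h.wf hD hRD hLegal)) (s.theta_nonneg OLD (h.wf.nonneg D hD))
  refine ⟨⟨hW', h.pos, h.lattice.move h.wf hLegal hρ, h.old_sub.trans (Finset.subset_insert _ _), ?_⟩, ?_⟩
  · -- every not-done cone of the new state has residual order ≤ 0
    intro D' hD' hd'
    rcases mem_move_cones.mp hD' with ⟨hD, hRD⟩ | ⟨D, hD, hRD, x, hx, rfl⟩
    · have hρD : ρ ∉ D' := not_mem_of_fresh h.wf hρ hD
      rw [theta_move_of_not_mem s R hρD]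
      refine h.theta_le D' hD (fun hdone => hd' ?_)
      obtain ⟨v, hv⟩ := hdone
      exact ⟨v, by rwa [fsum_move_of_not_mem s R hρD]⟩
    · have hρD : ρ ∉ D := not_mem_of_fresh h.wf hρ hD
      have := s.theta_child_le (OLD := OLD) hRD (hRD hx) hρD hρO (h.wf.nonneg D hD)
        (by rw [hθR, hD_theta D hD hRD])
      rw [hD_theta D hD hRD] at this
      exact this
  · -- the potential drops
    have hn : 1 ≤ n := by
      have := h.wf.card_eq C₀ hC₀
      have := Finset.card_pos.mpr (hRne.mono hRC₀)
      omega
    -- weight of a cone after / before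
    let w' : Finset ℕ → ℕ := fun D => (n + 1) ^ ⌊(N : ℚ) * (s.move R ρ).asum OLD D⌋₊
    let w : Finset ℕ → ℕ := fun D => (n + 1) ^ ⌊(N : ℚ) * s.asum OLD D⌋₊
    -- children of a cone through R weigh, together, less than the cone
    have hchild : ∀ D ∈ s.cones, R ⊆ D → ∑ D' ∈ childCones R D ρ, w' D' < w D := by
      intro D hD hRD
      have hρD : ρ ∉ D := not_mem_of_fresh h.wf hρ hD
      have hnnD := h.wf.nonneg D hD
      rw [childCones, if_pos hRD]
      have hinj : Set.InjOn (fun x => insert ρ (D.erase x)) R := by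
        intro x hx y hy hxy
        have hxD : x ∈ D := hRD hx
        by_contra hne
        have hxy' : insert ρ (D.erase x) = insert ρ (D.erase y) := hxy
        have : x ∉ insert ρ (D.erase x) := by
          simp [ne_of_mem_of_not_mem hxD hρD]
        rw [hxy'] at this
        exact this (Finset.mem_insert_of_mem (Finset.mem_erase.mpr ⟨hne, hxD⟩))
      rw [Finset.sum_image hinj]
      -- exponent bookkeeping: e := ⌊N Σ_D α⌋ ≥ 1 and each child has exponent ≤ e − 1
      have hDsum : 1 ≤ s.asum OLD D := hR1.trans (s.asum_le_asum_of_subset OLD hRD hnnD)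
      have hNpos : (0 : ℚ) < N := by exact_mod_cast h.pos
      have he1 : 1 ≤ ⌊(N : ℚ) * s.asum OLD D⌋₊ := by
        rw [Nat.le_floor_iff (by positivity)]
        have : (1 : ℚ) ≤ N := by exact_mod_cast h.pos
        push_cast; nlinarith
      have hbound : ∀ x ∈ R, w' (insert ρ (D.erase x)) ≤ (n + 1) ^ (⌊(N : ℚ) * s.asum OLD D⌋₊ - 1) := by
        intro x hx
        apply Nat.pow_le_pow_right (by omega)
        have hform := s.asum_child (OLD := OLD) (hRD hx) hρD hρO (R := R)
        rw [hθR] at hform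
        -- α_x − (Σ_R α − 1) ≥ 1/N
        have hgap : 1 / (N : ℚ) ≤ s.alpha OLD x - (s.asum OLD R - 1) := by
          have hlt : s.asum OLD R - 1 < s.alpha OLD x := by
            have := hmin x hx
            rw [asum, Finset.sum_erase_eq_sub hx] at this
            unfold asum; linarith
          refine one_div_le_of_lattice h.pos (s.exists_alpha_eq_div h.lattice hD (hRD hx)) ?_ hlt
          obtain ⟨z, hz⟩ := s.exists_asum_eq_div (OLD := OLD) h.lattice hD hRD
          exact ⟨z - N, by rw [hz]; push_cast; field_simp⟩
        have hle : (N : ℚ) * (s.move R ρ).asum OLD (insert ρ (D.erase x)) ≤ (N : ℚ) * s.asum OLD D - 1 := by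
          rw [hform]
          have : (N : ℚ) * (1 / (N : ℚ)) = 1 := by field_simp
          nlinarith
        calc ⌊(N : ℚ) * (s.move R ρ).asum OLD (insert ρ (D.erase x))⌋₊
            ≤ ⌊(N : ℚ) * s.asum OLD D - 1⌋₊ := Nat.floor_le_floor hle
          _ = ⌊(N : ℚ) * s.asum OLD D⌋₊ - 1 := Nat.floor_sub_one _
      calc ∑ x ∈ R, w' (insert ρ (D.erase x))
          ≤ ∑ x ∈ R, (n + 1) ^ (⌊(N : ℚ) * s.asum OLD D⌋₊ - 1) := Finset.sum_le_sum hbound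
        _ = R.card * (n + 1) ^ (⌊(N : ℚ) * s.asum OLD D⌋₊ - 1) := by rw [Finset.sum_const, smul_eq_mul]
        _ ≤ n * (n + 1) ^ (⌊(N : ℚ) * s.asum OLD D⌋₊ - 1) := by
            apply Nat.mul_le_mul_right
            rw [← h.wf.card_eq D hD]; exact Finset.card_le_card hRD
        _ < (n + 1) * (n + 1) ^ (⌊(N : ℚ) * s.asum OLD D⌋₊ - 1) :=
            Nat.mul_lt_mul_of_pos_right (Nat.lt_succ_self n) (Nat.pow_pos (by omega))
        _ = w D := by
            show (n + 1) * (n + 1) ^ (⌊(N : ℚ) * s.asum OLD D⌋₊ - 1) = (n + 1) ^ ⌊(N : ℚ) * s.asum OLD D⌋₊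
            rw [← pow_succ']
            congr 1; omega
    -- untouched cones keep their weight
    have hsame : ∀ D ∈ s.cones, ¬ R ⊆ D → ∑ D' ∈ childCones R D ρ, w' D' = w D := by
      intro D hD hRD
      rw [childCones, if_neg hRD, Finset.sum_singleton]
      show (n + 1) ^ ⌊(N : ℚ) * (s.move R ρ).asum OLD D⌋₊ = (n + 1) ^ ⌊(N : ℚ) * s.asum OLD D⌋₊
      rw [asum_move_of_not_mem s R (not_mem_of_fresh h.wf hρ hD)]
    -- assemble
    calc (s.move R ρ).mpot OLD N n
        = ∑ D' ∈ s.cones.biUnion (fun D => childCones R D ρ), w' D' := rfl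
      _ ≤ ∑ D ∈ s.cones, ∑ D' ∈ childCones R D ρ, w' D' := sum_biUnion_le_nat _ _ _
      _ < ∑ D ∈ s.cones, w D := by
          apply Finset.sum_lt_sum
          · intro D hD
            by_cases hRD : R ⊆ D
            · exact (hchild D hD hRD).le
            · exact (hsame D hD hRD).le
          · exact ⟨C₀, hC₀, hchild C₀ hC₀ hRC₀⟩
      _ = s.mpot OLD N n := rfl

/-- **THE MONOMIAL PHASE TERMINATES (Encinas–Villamayor's monomial case, existence form).**  A well-formed state in
which every not-done cone has residual order `0` is solvable: blow up inclusion-minimal faces of monomial order `≥ 1`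
until every cone is done; the potential `Σ_C (n+1)^{⌊N Σ_C α⌋}` strictly drops at each move.
[cite: EncinasVillamayor1998, §2 (the monomial case, printed pp. 115–116)] -/
theorem MonomialPhase.solvable {s : MGame ι} (h : s.MonomialPhase OLD N n) : s.Solvable := by
  suffices H : ∀ (m : ℕ) (t : MGame ι), t.MonomialPhase OLD N n → t.mpot OLD N n ≤ m → t.Solvable from
    H _ s h le_rfl
  intro m
  induction m with
  | zero =>
    intro t ht hm
    by_cases hall : t.AllDone
    · exact Solvable.done hall
    · obtain ⟨C₀, hC₀, hd₀⟩ : ∃ C ∈ t.cones, ¬ t.Done C := by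
        by_contra hcon; push Not at hcon; exact hall hcon
      obtain ⟨R, hR, hstep⟩ := ht.step hC₀ hd₀
      refine Solvable.step R hR (fun ρ hρ => ?_)
      have := (hstep ρ hρ).2
      omega
  | succ m ih =>
    intro t ht hm
    by_cases hall : t.AllDone
    · exact Solvable.done hall
    · obtain ⟨C₀, hC₀, hd₀⟩ : ∃ C ∈ t.cones, ¬ t.Done C := by
        by_contra hcon; push Not at hcon; exact hall hcon
      obtain ⟨R, hR, hstep⟩ := ht.step hC₀ hd₀
      refine Solvable.step R hR (fun ρ hρ => ?_)
      obtain ⟨hph, hlt⟩ := hstep ρ hρ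
      exact ih _ hph (by omega)

end MonomialPhase

end MGame

end Literature.Combinatorics.HironakaPolyhedraGame
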